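import Mathlib
import Literature.Computability.MetaComplexity.Frege
import HarnessLib

/-!
# Permutation-parity tautologies

A linear-size family of propositional tautologies indexed by permutations: for `π` a permutation
of `Fin n`, the formula `tauPerm π` says, with Tseitin-style gate variables, that the parity of
`x₀, …, x_{n-1}` summed in the standard order equals the parity summed in the order `π`:

  `¬(Chain(y; x₀, …, x_{n-1}) ∧ Chain(z; x_{π 0}, …, x_{π (n-1)})) ∨ (y_0 ↔ z_0)`

where `Chain(y; a₀, …, a_{k-1})` is the conjunction of the gate definitions
`y_j ↔ (a_j ⊕ y_{j+1})` (`j < k`) and `¬ y_k`, so that under any satisfying assignment the gate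
`y_0` carries the parity `a₀ ⊕ ⋯ ⊕ a_{k-1}`. This is the right-comb (linear) bracketing of the
parity of a PERMUTED sequence of variables, the parity instance of the permutation /
rearrangement tautologies of Pudlák–Buss (products of a generic sequence re-bracketed and
re-ordered; Orevkov's lower bound for tree-like Frege proofs), written with extension-style gate
variables as in Tseitin's graph tautologies so that the formula has size LINEAR in `n`
(`size_tauPerm : (tauPerm π).size = 52 * n + 16`).

* `PermutationParity.xorVar a b` — the formula `x_a ⊕ x_b` in the basis `¬, ∧, ∨` (size `9`).
* `PermutationParity.chain l g` — the gate chain over the leaf variables `l : List ℕ` with gate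
  variables `g, g + 1, …, g + |l|` (size `26 · |l| + 2`).
* `PermutationParity.tauPerm π` — the permutation-parity tautology of `π : Equiv.Perm (Fin n)`:
  leaves `0, …, n - 1`, first gate chain `n, …, 2n`, second gate chain `2n + 1, …, 3n + 1`.
* `PermutationParity.lparity` — the parity (iterated `xor`) of a list of Booleans;
  `lparity_perm` — invariance under permutations.
* Proved: `eval_chain` (a satisfied chain forces its head gate to the parity of its leaves),
  `isTautology_tauPerm`, `size_chain`, `size_tauPerm`.

These tautologies are the hard examples of the hub route `FregeLinesACUniverse` (sub-problem
`PneNP`), which compares the number of LINES of their Frege proofs with the AC-rearrangement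
universe `ACRewriting.acUniverse π` (`ACRearrangement.lean`). Only the family, its validity and
its size are formalised here; no lower or upper bound on proofs is claimed.

## Sources

* P. Pudlák, S. Buss, *How to lie without being (easily) convicted and the lengths of proofs in
  propositional calculus*, CSL '94, LNCS 933 (1995), §4 (permutation tautologies; Orevkov's
  `Ω(n log n)` rearrangement bound for tree-like proofs).
* G. S. Tseitin, *On the complexity of derivation in propositional calculus* (1968) (gate /
  extension variables encoding parity constraints).
* A. Urquhart, *Hard examples for resolution*, J. ACM 34 (1987) (parity/graph tautologies).

## Design choices

* Formulas are G01's `PropForm ℕ` (basis `var/const/neg/conj/disj`), biimplication is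
  `PropForm.biimp` of `Frege.lean`; `⊕` is spelled out (`xorVar`) so that sizes are explicit.
* Gate variables are allocated arithmetically (`g, g + 1, …`); the three variable blocks of
  `tauPerm` are disjoint by construction (`0 … n-1`, `n … 2n`, `2n+1 … 3n+1`), which the
  tautology proof does not even need (validity holds for any allocation).
* Mathlib has no propositional tautology families (searched `Tseitin`, `pigeonhole` in
  `PropForm`/proof-complexity files of this library: only `PHP`-style families elsewhere).
-/

namespace Literature.Computability.MetaComplexity

namespace PermutationParity

open Literature.Computability.Complexity
open Literature.Computability.Complexity.PropForm

/-- The formula `x_a ⊕ x_b := (x_a ∧ ¬x_b) ∨ (¬x_a ∧ x_b)` (size `9`).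
[cite: Tseitin1968, §1 (parity constraints as clauses/formulas)] -/
def xorVar (a b : ℕ) : PropForm ℕ :=
  disj (conj (var a) (neg (var b))) (conj (neg (var a)) (var b))

/-- Semantics of `xorVar`. [cite: Tseitin1968, §1] -/
@[simp] theorem eval_xorVar (σ : ℕ → Bool) (a b : ℕ) :
    (xorVar a b).eval σ = Bool.xor (σ a) (σ b) := by
  cases ha : σ a <;> cases hb : σ b <;> simp [xorVar, PropForm.eval, ha, hb]

/-- Size of `xorVar`. [cite: Tseitin1968, §1] -/
@[simp] theorem size_xorVar (a b : ℕ) : (xorVar a b).size = 9 := by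
  simp [xorVar, PropForm.size]

/-- The gate chain `Chain(g; l)`: for leaves `l = [a₀, …, a_{k-1}]` and first gate variable `g`,
the conjunction of `x_g ↔ (x_{a₀} ⊕ x_{g+1})`, `x_{g+1} ↔ (x_{a₁} ⊕ x_{g+2})`, …, and `¬ x_{g+k}`
— the Tseitin encoding of "`x_g` is the parity of the leaves, computed as a right comb".
[cite: Tseitin1968, §1 (extension variables for parity)] -/
def chain : List ℕ → ℕ → PropForm ℕ
  | [], g => neg (var g)
  | a :: l, g => conj (PropForm.biimp (var g) (xorVar a (g + 1))) (chain l (g + 1))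

/-- The parity (iterated exclusive or, right fold) of a list of Booleans. [folklore] -/
def lparity (l : List Bool) : Bool :=
  l.foldr Bool.xor false

/-- Parity of a cons. [folklore] -/
@[simp] theorem lparity_cons (b : Bool) (l : List Bool) :
    lparity (b :: l) = Bool.xor b (lparity l) := rfl

/-- Parity of the empty list. [folklore] -/
@[simp] theorem lparity_nil : lparity [] = false := rfl

/-- Parity is invariant under permutations of the list. [folklore] -/
theorem lparity_perm {l₁ l₂ : List Bool} (h : l₁.Perm l₂) : lparity l₁ = lparity l₂ := by
  haveI : LeftCommutative Bool.xor := ⟨Bool.xor_left_comm⟩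
  exact h.foldr_eq false

/-- A satisfied gate chain forces its head gate variable to the parity of its leaves.
[cite: Tseitin1968, §1] -/
theorem eval_chain (σ : ℕ → Bool) :
    ∀ (l : List ℕ) (g : ℕ), (chain l g).eval σ = true → σ g = lparity (l.map σ) := by
  intro l
  induction l with
  | nil =>
    intro g h
    simpa [chain, PropForm.eval] using h
  | cons a l ih =>
    intro g h
    simp only [chain, PropForm.eval, Bool.and_eq_true] at h
    obtain ⟨h₁, h₂⟩ := h
    have hg := ih (g + 1) h₂
    rw [PropForm.eval_biimp] at h₁
    simp only [PropForm.eval, eval_xorVar, beq_iff_eq] at h₁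
    rw [h₁, hg]
    simp

/-- Size of a gate chain: `26 · |l| + 2`. [cite: Tseitin1968, §1] -/
theorem size_chain : ∀ (l : List ℕ) (g : ℕ), (chain l g).size = 26 * l.length + 2 := by
  intro l
  induction l with
  | nil => intro g; simp [chain, PropForm.size]
  | cons a l ih =>
    intro g
    simp only [chain, PropForm.size, PropForm.biimp, size_xorVar, ih (g + 1), List.length_cons]
    ring

variable {n : ℕ}

/-- The PERMUTATION-PARITY TAUTOLOGY of `π : Equiv.Perm (Fin n)`:
`¬(Chain(n; 0, 1, …, n-1) ∧ Chain(2n+1; π 0, π 1, …, π (n-1))) ∨ (x_n ↔ x_{2n+1})` — "the parity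
of `x₀, …, x_{n-1}` in the standard order equals their parity in the order `π`", with linear-size
Tseitin gate chains. [cite: PudlakBuss1995, §4 (permutation tautologies), parity instance with Tseitin1968 gate variables] -/
def tauPerm (π : Equiv.Perm (Fin n)) : PropForm ℕ :=
  disj (neg (conj (chain (List.ofFn fun i : Fin n => (i : ℕ)) n)
      (chain (List.ofFn fun i : Fin n => ((π i : Fin n) : ℕ)) (2 * n + 1))))
    (PropForm.biimp (var n) (var (2 * n + 1)))

/-- The permutation-parity formulas are tautologies (parity is permutation invariant).
[cite: PudlakBuss1995, §4] -/
theorem isTautology_tauPerm (π : Equiv.Perm (Fin n)) : (tauPerm π).IsTautology := by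
  intro σ
  simp only [tauPerm, PropForm.eval, PropForm.eval_biimp]
  cases h₁ : (chain (List.ofFn fun i : Fin n => (i : ℕ)) n).eval σ
  · simp
  cases h₂ : (chain (List.ofFn fun i : Fin n => ((π i : Fin n) : ℕ)) (2 * n + 1)).eval σ
  · simp
  have e₁ := eval_chain σ _ _ h₁
  have e₂ := eval_chain σ _ _ h₂
  rw [List.map_ofFn] at e₁ e₂
  have hp : (List.ofFn ((σ ∘ fun i : Fin n => (i : ℕ)) ∘ π)).Perm
      (List.ofFn (σ ∘ fun i : Fin n => (i : ℕ))) :=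
    Equiv.Perm.ofFn_comp_perm π _
  have : σ (2 * n + 1) = σ n := by
    rw [e₁, e₂]
    exact lparity_perm (by simpa [Function.comp_def] using hp)
  simp [this]

/-- The permutation-parity tautologies have size linear in `n`: exactly `52 n + 16`.
[cite: PudlakBuss1995, §4] -/
theorem size_tauPerm (π : Equiv.Perm (Fin n)) : (tauPerm π).size = 52 * n + 16 := by
  simp only [tauPerm, PropForm.size, PropForm.biimp, size_chain, List.length_ofFn]
  ring

/-- In particular the size of `tauPerm π` is positive and at most `68 · n + 16`-free form:
`(tauPerm π).size ≤ 68 * (n + 1)` — the shape used when comparing with `n + 1`-indexed costs.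
[cite: PudlakBuss1995, §4] -/
theorem size_tauPerm_le (π : Equiv.Perm (Fin n)) : (tauPerm π).size ≤ 68 * (n + 1) := by
  rw [size_tauPerm]; omega

end PermutationParity

end Literature.Computability.MetaComplexity
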